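import Literature.NumberTheory.ModularForms.ModPModularFormsSerreDerivative
import HarnessLib

/-!
# Modular forms mod `p` on `Γ₁(N)`: `M̃(N) = Σ_k M̃_k(N)` is multiplicatively graded — `M̃_{k₁}(N) · M̃_{k₂}(N) ⊆ M̃_{k₁+k₂}(N)`

Topic `Literature/NumberTheory/ModularForms`, sub-namespace `ModP`. THEOREMS ONLY (no definition, no named fact); sequel of
`ModPModularFormsQExpansion.lean` / `ModPModularFormsSerreDerivative.lean`. N. Jochnowitz, Trans. AMS 270 (1982) §1 p. 270: "We define
the space of all modular forms mod `l` of level `N`, `M̃(N)`, to be the subalgebra of `𝔽_l[[q]]` which is the sum of the `M̃_k(N)`" — the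
product of a form of weight `k₁` and one of weight `k₂` with rational `p`-integral expansions is one of weight `k₁ + k₂` with the Cauchy-product
expansion (Mathlib `ModularForm.mul`, `HasRationalPIntegralQExpansion.mul`), so the reductions multiply accordingly. For users assembling a
member of `M̃_κ(N)` as a product of reductions (e.g. a cut Eisenstein-type series times a power of a theta series).

* `mul_mem_modPForms` — `g ∈ M̃_{k₁}(N)`, `h ∈ M̃_{k₂}(N)` ⟹ `g·h ∈ M̃_{k₁+k₂}(N)`;
* `one_mem_modPForms_zero`, `pow_mem_modPForms` — `g ∈ M̃_k(N)` ⟹ `gⁿ ∈ M̃_{n·k}(N)`.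

## References
* [Jochnowitz1982] §1 Def. 1.1 and the sentence following it (p. 270).
-/

noncomputable section

open scoped Classical
open PowerSeries CongruenceSubgroup Finset

namespace Literature.NumberTheory.ModularForms.ModP

variable {p : ℕ} [Fact p.Prime] {N : ℕ}

/-- **`M̃_{k₁}(N) · M̃_{k₂}(N) ⊆ M̃_{k₁+k₂}(N)`**: products of modular forms mod `p` (by `q`-expansion) are modular forms mod `p` of the summed
weight ("`M̃(N)` … the subalgebra of `𝔽_l[[q]]` which is the sum of the `M̃_k(N)`"). [cite: Jochnowitz1982, §1 p. 270 (after Def. 1.1)] -/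
theorem mul_mem_modPForms {k₁ k₂ : ℕ} {g h : PowerSeries (ZMod p)} (hg : g ∈ modPForms p N k₁) (hh : h ∈ modPForms p N k₂) :
    g * h ∈ modPForms p N (k₁ + k₂) := by
  obtain ⟨f, x, hf, hgx⟩ := hg
  obtain ⟨f', y, hf', hhy⟩ := hh
  have hw : (k₁ : ℤ) + (k₂ : ℤ) = ((k₁ + k₂ : ℕ) : ℤ) := by push_cast; ring
  refine ⟨_, _, (hf.mul hf').mcast hw, fun n => ?_⟩
  rw [coeff_mul, map_sum]
  exact sum_congr rfl fun ij _ => by rw [hgx, hhy, map_mul]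

/-- `1 ∈ M̃_0(N)` (the constant form). [cite: Jochnowitz1982, §1 p. 270 (after Def. 1.1)] -/
theorem one_mem_modPForms_zero : (1 : PowerSeries (ZMod p)) ∈ modPForms p N 0 := by
  have h : (1 : PowerSeries (ZMod p)) = C (1 : ZMod p) := (map_one _).symm
  rw [h]
  exact C_mem_modPForms_zero 1

/-- **Powers**: `g ∈ M̃_k(N)` ⟹ `gⁿ ∈ M̃_{n·k}(N)`. [cite: Jochnowitz1982, §1 p. 270 (after Def. 1.1)] -/
theorem pow_mem_modPForms {k : ℕ} {g : PowerSeries (ZMod p)} (hg : g ∈ modPForms p N k) (n : ℕ) :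
    g ^ n ∈ modPForms p N (n * k) := by
  induction n with
  | zero =>
    rw [pow_zero, zero_mul]
    exact one_mem_modPForms_zero
  | succ n ih =>
    rw [pow_succ, show (n + 1) * k = n * k + k by ring]
    exact mul_mem_modPForms ih hg

end Literature.NumberTheory.ModularForms.ModP
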